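import Summits.Ventures.Crystal3D.Theorems.StickyWulffConstantNoReconstructionGainCubeLowCoordGeom
import Summits.Ventures.Crystal3D.Theorems.StickyWulffConstantNoReconstructionGainSquareDiscUpper
import HarnessLib

/-!
# The rim of the `(100)` slab sample has `O(ρ)` sites

HONEST FRAMING. Part of the venture `Summits/Ventures/Crystal3D` (cell `crystal3d-full`), helper
`--supports` the crux `NoReconstructionGain` (stmt-Ventures-19144, route
`route-Ventures-StickyWulffConstant`).  Counting only: with `P` the `(100)` slab sample
(`ν₁₀₀`, `R = 4`: sites of `fccStacking 1 √(2/3)` with `−8 ≤ η ≤ −4`, lateral radius `≤ ρ`; six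
square layers `s = −11, …, −6`, layer `s` being `(ℤ − s/2) × (ℤ + s/2)` in the cube frame), the
sites with lateral radius `> ρ − 2` number at most `72 π ρ` for `ρ ≥ 4` (`card_cubeRim_le`): per
layer `#disc(ρ) ≤ π(ρ+2)²` (`square_disc_count_upper`) minus `π(ρ−4)² ≤ #disc(ρ−2)`
(`square_disc_count`) is `≤ 12π(ρ − 1)`.

WHAT THIS IS NOT: nothing about packings beyond counting; rung F-C1 not moved.
-/

noncomputable section

namespace Summit.Ventures.Crystal3D.Theorems

open Summit.Ventures.Crystal3D Finset Real
open Literature.MathematicalPhysics.StatisticalMechanics (barlowPos barlowStacking fccStacking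
  constHagg isHaggSeq_const barlowPos_mem le_dist_barlowPos_of_ideal)
open scoped InnerProductSpace

/-- **Cube rim count.**  With `P` the `(100)` slab sample as above (`ρ ≥ 4`), the sites of `P` with
`‖p‖² − η(p)² > (ρ − 2)²` number at most `72 π ρ`. -/
theorem card_cubeRim_le (ρ : ℝ) (hρ : 4 ≤ ρ) (P : Finset (EuclideanSpace ℝ (Fin 3)))
    (hP : ∀ p, p ∈ P ↔ (p ∈ fccStacking 1 (Real.sqrt (2 / 3)) ∧
      -8 ≤ ⟪p, (!₂[Real.sqrt 2 / 2, Real.sqrt 6 / 6, -(Real.sqrt 3 / 3)] : EuclideanSpace ℝ (Fin 3))⟫_ℝ ∧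
      ⟪p, (!₂[Real.sqrt 2 / 2, Real.sqrt 6 / 6, -(Real.sqrt 3 / 3)] : EuclideanSpace ℝ (Fin 3))⟫_ℝ ≤ -4 ∧
      ‖p‖ ^ 2 - ⟪p, (!₂[Real.sqrt 2 / 2, Real.sqrt 6 / 6, -(Real.sqrt 3 / 3)] :
        EuclideanSpace ℝ (Fin 3))⟫_ℝ ^ 2 ≤ ρ ^ 2)) :
    ((P.filter fun p => (ρ - 2) ^ 2 < ‖p‖ ^ 2 -
      ⟪p, (!₂[Real.sqrt 2 / 2, Real.sqrt 6 / 6, -(Real.sqrt 3 / 3)] : EuclideanSpace ℝ (Fin 3))⟫_ℝ ^ 2).card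
      : ℝ) ≤ 72 * Real.pi * ρ := by
  classical
  set ν : EuclideanSpace ℝ (Fin 3) := !₂[Real.sqrt 2 / 2, Real.sqrt 6 / 6, -(Real.sqrt 3 / 3)] with hν
  set e₁ : EuclideanSpace ℝ (Fin 3) := !₂[1 / 2, -(Real.sqrt 3 / 2), 0] with he₁
  set e₂ : EuclideanSpace ℝ (Fin 3) := !₂[1 / 2, Real.sqrt 3 / 6, Real.sqrt 6 / 3] with he₂
  obtain ⟨hc2, hc7, hc8⟩ := sqrt_two_half_bounds
  set c : ℝ := Real.sqrt 2 / 2 with hcdef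
  have hcpos : 0 < c := by linarith
  have hh : (Real.sqrt (2 / 3)) ^ 2 = 2 / 3 * (1 : ℝ) ^ 2 := by rw [Real.sq_sqrt (by norm_num)]; ring
  have hfcc_inj : ∀ {k₁ a₁ b₁ k₂ a₂ b₂ : ℤ},
      barlowPos 1 (Real.sqrt (2 / 3)) constHagg k₁ a₁ b₁ =
        barlowPos 1 (Real.sqrt (2 / 3)) constHagg k₂ a₂ b₂ → (k₁, a₁, b₁) = (k₂, a₂, b₂) := by
    intro k₁ a₁ b₁ k₂ a₂ b₂ heq
    by_contra hne
    have h1 := le_dist_barlowPos_of_ideal isHaggSeq_const one_pos hh hne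
    rw [heq, dist_self] at h1
    exact absurd h1 (by norm_num)
  have hlat : ∀ v : EuclideanSpace ℝ (Fin 3), ‖v‖ ^ 2 - ⟪v, ν⟫_ℝ ^ 2 = ⟪v, e₁⟫_ℝ ^ 2 + ⟪v, e₂⟫_ℝ ^ 2 := by
    intro v; rw [norm_sq_eq_cubeFrame v]; ring
  have hη : ∀ k i j : ℤ, ⟪barlowPos 1 (Real.sqrt (2 / 3)) constHagg k i j, ν⟫_ℝ = ((i : ℝ) + j) * c := by
    intro k i j; rw [hν, inner_barlowPos_cubeNormal]
  -- coordinates of the sample sites: `i + j = s ∈ [-11, -6]`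
  have hcoord : ∀ p ∈ P, ∃ s k i : ℤ, -11 ≤ s ∧ s ≤ -6 ∧
      p = barlowPos 1 (Real.sqrt (2 / 3)) constHagg k i (s - i) := by
    intro p hp
    obtain ⟨hΛ, hz1, hz2, -⟩ := (hP p).1 hp
    obtain ⟨k, i, j, rfl⟩ := hΛ
    rw [hη] at hz1 hz2
    refine ⟨i + j, k, i, ?_, ?_, by rw [show i + j - i = j by ring]⟩
    · by_contra hs
      have : ((i : ℝ) + j) ≤ -12 := by exact_mod_cast (show i + j ≤ -12 by omega)
      nlinarith
    · by_contra hs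
      have : (-5 : ℝ) ≤ (i : ℝ) + j := by exact_mod_cast (show -5 ≤ i + j by omega)
      nlinarith
  set K : Finset ℤ := Finset.Icc (-11) (-6) with hK
  have hKcard : K.card = 6 := by rw [hK]; rfl
  set rim := P.filter fun p => (ρ - 2) ^ 2 < ‖p‖ ^ 2 - ⟪p, ν⟫_ℝ ^ 2 with hrim
  set layer : ℤ → Finset (EuclideanSpace ℝ (Fin 3)) := fun s =>
    P.filter fun p => ⟪p, ν⟫_ℝ = (s : ℝ) * c with hlayer
  have hrim_sub : rim ⊆ K.biUnion fun s =>
      (layer s).filter fun p => (ρ - 2) ^ 2 < ‖p‖ ^ 2 - ⟪p, ν⟫_ℝ ^ 2 := by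
    intro p hp
    rw [hrim, mem_filter] at hp
    obtain ⟨s, k, i, hs1, hs2, hps⟩ := hcoord p hp.1
    rw [mem_biUnion]
    refine ⟨s, by rw [hK, Finset.mem_Icc]; exact ⟨hs1, hs2⟩, ?_⟩
    rw [mem_filter, hlayer, mem_filter]
    exact ⟨⟨hp.1, by rw [hps, hη]; push_cast; ring⟩, hp.2⟩
  have hper : ∀ s ∈ K, (((layer s).filter fun p => (ρ - 2) ^ 2 < ‖p‖ ^ 2 - ⟪p, ν⟫_ℝ ^ 2).card : ℝ)
      ≤ 12 * Real.pi * ρ := by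
    intro s hs
    rw [hK, Finset.mem_Icc] at hs
    have hidx : ∀ p ∈ layer s, ∃ ki : ℤ × ℤ,
        p = barlowPos 1 (Real.sqrt (2 / 3)) constHagg ki.1 ki.2 (s - ki.2) := by
      intro p hp
      rw [hlayer, mem_filter] at hp
      obtain ⟨s', k, i, -, -, hps⟩ := hcoord p hp.1
      have : s' = s := by
        have hz := hp.2
        rw [hps, hη] at hz
        push_cast at hz
        have : ((s' : ℝ)) * c = (s : ℝ) * c := by linarith
        exact_mod_cast mul_right_cancel₀ hcpos.ne' this
      exact ⟨(k, i), by rw [hps, this]⟩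
    set g : EuclideanSpace ℝ (Fin 3) → ℤ × ℤ := fun p =>
      if hq : ∃ ki : ℤ × ℤ, p = barlowPos 1 (Real.sqrt (2 / 3)) constHagg ki.1 ki.2 (s - ki.2)
      then hq.choose else (0, 0) with hg
    have hg_spec : ∀ p ∈ layer s,
        p = barlowPos 1 (Real.sqrt (2 / 3)) constHagg (g p).1 (g p).2 (s - (g p).2) := by
      intro p hp
      have hex := hidx p hp
      rw [hg]; simp only [hex, dif_pos]
      exact hex.choose_spec
    have hg_inj : Set.InjOn g ↑(layer s) := by
      intro p hp p' hp' hpp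
      rw [hg_spec p (mem_coe.1 hp), hg_spec p' (mem_coe.1 hp'), hpp]
    -- lateral radius of a layer-`s` site `(k, i)` in the square-lattice form
    have hlatsite : ∀ k i : ℤ, ‖barlowPos 1 (Real.sqrt (2 / 3)) constHagg k i (s - i)‖ ^ 2 -
        ⟪barlowPos 1 (Real.sqrt (2 / 3)) constHagg k i (s - i), ν⟫_ℝ ^ 2 =
        ((i : ℝ) - (s : ℝ) / 2) ^ 2 + ((k : ℝ) - (-(s : ℝ) / 2)) ^ 2 := by
      intro k i
      rw [hlat, he₁, he₂, inner_barlowPos_cubeFrame₁, inner_barlowPos_cubeFrame₂]; push_cast; ring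
    set Tup : Finset (ℤ × ℤ) := (layer s).image (fun p => ((g p).2, (g p).1)) with hTup
    have hswap_inj : Set.InjOn (fun p => ((g p).2, (g p).1)) ↑(layer s) := by
      intro p hp p' hp' hpp
      simp only [Prod.mk.injEq] at hpp
      exact hg_inj hp hp' (Prod.ext hpp.2 hpp.1)
    have hup := square_disc_count_upper ((s : ℝ) / 2) (-(s : ℝ) / 2) ρ (by linarith) Tup (by
      intro ik hik
      rw [hTup, mem_image] at hik
      obtain ⟨p, hp, rfl⟩ := hik
      have hpP : p ∈ P := (mem_filter.1 (show p ∈ layer s from hp)).1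
      have hl := ((hP p).1 hpP).2.2.2
      rw [hg_spec p hp, hlatsite] at hl
      exact hl)
    have hTup_card : Tup.card = (layer s).card := by rw [hTup, card_image_of_injOn hswap_inj]
    set inner := (layer s).filter fun p => ‖p‖ ^ 2 - ⟪p, ν⟫_ℝ ^ 2 ≤ (ρ - 2) ^ 2 with hinner
    set Tlo : Finset (ℤ × ℤ) := inner.image (fun p => ((g p).2, (g p).1)) with hTlo
    have hlo := square_disc_count ((s : ℝ) / 2) (-(s : ℝ) / 2) (ρ - 2) (by linarith) Tlo (by
      intro i k hcond
      set p := barlowPos 1 (Real.sqrt (2 / 3)) constHagg k i (s - i) with hpdef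
      have hl : ‖p‖ ^ 2 - ⟪p, ν⟫_ℝ ^ 2 ≤ (ρ - 2) ^ 2 := by rw [hpdef, hlatsite]; exact hcond
      have hpP : p ∈ P := by
        rw [hP]
        refine ⟨barlowPos_mem _ _ _, ?_, ?_, by nlinarith⟩
        · rw [hpdef, hη]; push_cast
          have : (-11 : ℝ) ≤ s := by exact_mod_cast hs.1
          nlinarith
        · rw [hpdef, hη]; push_cast
          have : (s : ℝ) ≤ -6 := by exact_mod_cast hs.2
          nlinarith
      have hpl : p ∈ layer s := by
        rw [hlayer, mem_filter]; refine ⟨hpP, ?_⟩; rw [hpdef, hη]; push_cast; ring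
      have hpi : p ∈ inner := by rw [hinner, mem_filter]; exact ⟨hpl, hl⟩
      have hgp : g p = (k, i) := by
        have := hfcc_inj ((hg_spec p hpl).symm.trans hpdef)
        simp only [Prod.mk.injEq] at this
        exact Prod.ext this.1 this.2.1
      rw [hTlo, mem_image]; exact ⟨p, hpi, by rw [hgp]⟩)
    have hTlo_card : Tlo.card = inner.card := by
      rw [hTlo, card_image_of_injOn fun p hp p' hp' hpp =>
        hswap_inj (mem_coe.2 (mem_filter.1 (mem_coe.1 hp)).1)
          (mem_coe.2 (mem_filter.1 (mem_coe.1 hp')).1) hpp]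
    have hsplit : ((layer s).filter fun p => (ρ - 2) ^ 2 < ‖p‖ ^ 2 - ⟪p, ν⟫_ℝ ^ 2).card + inner.card =
        (layer s).card := by
      rw [hinner]
      have := card_filter_add_card_filter_not (s := layer s)
        (fun p => (ρ - 2) ^ 2 < ‖p‖ ^ 2 - ⟪p, ν⟫_ℝ ^ 2)
      rw [← this]
      congr 2
      exact filter_congr fun p _ => by simp [not_lt]
    have e1 : (((layer s).filter fun p => (ρ - 2) ^ 2 < ‖p‖ ^ 2 - ⟪p, ν⟫_ℝ ^ 2).card : ℝ) =
        (Tup.card : ℝ) - (Tlo.card : ℝ) := by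
      rw [hTup_card, hTlo_card]
      have : (((layer s).filter fun p => (ρ - 2) ^ 2 < ‖p‖ ^ 2 - ⟪p, ν⟫_ℝ ^ 2).card : ℝ) +
          (inner.card : ℝ) = ((layer s).card : ℝ) := by exact_mod_cast hsplit
      linarith
    rw [e1]
    have hlo' : Real.pi * (ρ - 2 - 2) ^ 2 ≤ (Tlo.card : ℝ) := hlo
    have hdiff : Real.pi * (ρ + 2) ^ 2 - Real.pi * (ρ - 2 - 2) ^ 2 = Real.pi * (12 * ρ - 12) := by ring
    nlinarith [hup, hlo', hdiff, Real.pi_pos]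
  calc (rim.card : ℝ)
      ≤ ((K.biUnion fun s => (layer s).filter fun p => (ρ - 2) ^ 2 < ‖p‖ ^ 2 - ⟪p, ν⟫_ℝ ^ 2).card : ℝ) := by
        exact_mod_cast card_le_card hrim_sub
    _ ≤ ∑ s ∈ K, (((layer s).filter fun p => (ρ - 2) ^ 2 < ‖p‖ ^ 2 - ⟪p, ν⟫_ℝ ^ 2).card : ℝ) := by
        exact_mod_cast card_biUnion_le
    _ ≤ ∑ _s ∈ K, 12 * Real.pi * ρ := sum_le_sum hper
    _ = 72 * Real.pi * ρ := by rw [sum_const, hKcard]; ring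

end Summit.Ventures.Crystal3D.Theorems

end
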